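import Summits.CriticalPhenomena.Ising3D.TaylorCertificateOddDominated
import Literature.MathematicalPhysics.QuantumFieldTheory.ConformalBootstrap3D.BlockZSeriesABOfLt
import Literature.MathematicalPhysics.QuantumFieldTheory.ConformalBootstrap3D.BlockPoleNonexistence
import Mathlib.Tactic.Linarith
import Mathlib.Tactic.Positivity
import Mathlib.Tactic.Ring
import HarnessLib

/-!
# The odd sector of a derivative certificate at EVERY `Δ` above the bound, and AT the bound
(cell `pub-ising3x`, seat boot-1; closes the 'regular point' gap of `TaylorCertificateTermwise` in the odd
sector: accidental degeneracies via `BlockZSeriesABOfLt`, the bound `Δ = ℓ+1` by non-existence of the block)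

HONEST FRAMING: lottery ticket; floor = tightest certified 3D Ising CFT bounds; no exact-solution
claim without a proof.

* `IsTaylorFunctional.hasSum_crossF_hrZTermAB_self_of_lt` / `_neg_of_lt` — termwise evaluation of a
  derivative functional on the `gpm` / signed `gmm` series at every `Δ` strictly above the unitarity bound
  (no regularity hypothesis; `Δ ≠ 1` if `ℓ = 0` for the signed one);
* `hasSum_oddForm_of_isTaylorAt_of_lt`, `oddPositive_of_isTaylorAt_of_termwise_of_lt`;
* `oddPositive_bound_of_ne_zero` — at `Δ = ℓ+1`, `ℓ ≥ 1`, `Δσ ≠ Δε`: `OddPositive` holds vacuously (no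
  `⟨σεσε⟩` block exists there, `not_isConformalBlock3D_of_pole`);
* `tail_odd_of_dominated` — the (D5) tail obligation of `MixedObligations` for a derivative functional from
  the dominated termwise inequality at every `(Δ, ℓ, n, j)` of the tail (`E₀ > 1`, `Δσ ≠ Δε` on `Q`).
Sources: Dolan–Osborn 2004 §3; Kos–Poland–Simmons-Duffin 2014 §3.3 eq. (3.16), §4 (pole at the bound).
-/

namespace Summit.CriticalPhenomena.Ising3D

open Finset Set
open Literature.MathematicalPhysics.QuantumFieldTheory.ConformalBootstrap3D

/-- `gpm`-type family, every `Δ` strictly above the bound. [cite: DolanOsborn2004, §3 eqs. (3.9)–(3.12)] -/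
theorem IsTaylorFunctional.hasSum_crossF_hrZTermAB_self_of_lt {x : ℝ} (hx0 : 0 < x) (hx1 : x < 1)
    {φ : (ℝ → ℝ → ℝ) →ₗ[ℝ] ℝ} (hφ : IsTaylorFunctional x x φ) (s σ : ℝ) {Δ₁₂ Δ₃₄ Δ : ℝ} {ℓ : ℕ}
    {g : ℝ → ℝ → ℝ} (hΔ : unitarityBound3D ℓ < Δ) (hab : Δ₁₂ = -Δ₃₄)
    (hg : IsConformalBlock3D Δ₁₂ Δ₃₄ Δ ℓ g) :
    HasSum (fun q : ℕ × ℕ => hrCoeffAB (Δ₃₄ / 2) (Δ₃₄ / 2) Δ ℓ q.1 q.2 / legendreLam ℓ *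
        φ (crossF s σ (zMono (Δ + (q.1 : ℝ)) q.2))) (φ (crossF s σ g)) := by
  have hℓΔ : (ℓ : ℝ) ≤ Δ := (natCast_le_unitarityBound3D ℓ).trans hΔ.le
  refine hφ.hasSum_crossF_zMono_series hx0 hx1 s σ hℓΔ _
    (fun q => hrCoeffAB (Δ₃₄ / 2) (Δ₃₄ / 2) Δ ℓ q.1 q.2 / legendreLam ℓ) (fun q hq => ?_)
    (fun q => le_of_eq (abs_of_nonneg (div_nonneg (hrCoeffAB_self_nonneg _ hΔ _ _)
      (legendreLam_pos ℓ).le))) (fun z zb hz hzb => hg.hasSum_hrZTermAB_of_lt hΔ hab hz hzb)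
    fun X hX0 hX1 => (hg.hasSum_hrZTermAB_of_lt hΔ hab (x := X) (y := X) ⟨hX0, hX1⟩ ⟨hX0, hX1⟩).summable
  rw [hrCoeffAB_eq_zero_of_lt _ _ _ hq, zero_div]

/-- Signed `gmm`-type family, every `Δ` strictly above the bound (`Δ ≠ 1` if `ℓ = 0`).
[cite: DolanOsborn2004, §3 eq. (3.11)] -/
theorem IsTaylorFunctional.hasSum_crossF_hrZTermAB_neg_of_lt {x : ℝ} (hx0 : 0 < x) (hx1 : x < 1)
    {φ : (ℝ → ℝ → ℝ) →ₗ[ℝ] ℝ} (hφ : IsTaylorFunctional x x φ) (s σ : ℝ) {t Δ : ℝ} {ℓ : ℕ}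
    {gmm gpm : ℝ → ℝ → ℝ} (hΔ : unitarityBound3D ℓ < Δ) (h1 : ℓ = 0 → Δ ≠ 1)
    (hmm : IsConformalBlock3D t t Δ ℓ gmm) (hpm : IsConformalBlock3D (-t) t Δ ℓ gpm) :
    HasSum (fun q : ℕ × ℕ => hrCoeffAB (-t / 2) (t / 2) Δ ℓ q.1 q.2 / legendreLam ℓ *
        φ (crossF s σ (zMono (Δ + (q.1 : ℝ)) q.2))) (φ (crossF s σ gmm)) := by
  have hℓΔ : (ℓ : ℝ) ≤ Δ := (natCast_le_unitarityBound3D ℓ).trans hΔ.le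
  have hlam := legendreLam_pos ℓ
  have hconj : IsConformalBlock3D t (-t) Δ ℓ (conjBlock t gpm) := by
    have h := hpm.conj
    have he : (t - -t) / 2 = t := by ring
    rw [neg_neg, he] at h
    exact h
  refine hφ.hasSum_crossF_zMono_series hx0 hx1 s σ hℓΔ _
    (fun q => (hrCoeffAB (t / 2) (t / 2) Δ ℓ q.1 q.2 + hrCoeffAB (-t / 2) (-t / 2) Δ ℓ q.1 q.2) /
      (2 * legendreLam ℓ)) (fun q hq => ?_) (fun q => ?_)
    (fun z zb hz hzb => (hmm.hasSum_hrZTermAB_neg_of_lt hΔ h1 hpm hz hzb).1) fun X hX0 hX1 => ?_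
  · rw [hrCoeffAB_eq_zero_of_lt _ _ _ hq, zero_div]
  · have hb := abs_hrCoeffAB_neg_le (a := -t / 2) hΔ h1 q.1 q.2
    rw [show -(-t / 2) = t / 2 by ring] at hb
    rw [abs_div, abs_of_pos hlam, div_le_div_iff₀ hlam (by positivity)]
    nlinarith [hb, hlam]
  · have hP := (hpm.hasSum_hrZTermAB_of_lt hΔ (by ring) (x := X) (y := X) ⟨hX0, hX1⟩
      ⟨hX0, hX1⟩).summable
    have hQ := (hconj.hasSum_hrZTermAB_of_lt hΔ (by ring) (x := X) (y := X) ⟨hX0, hX1⟩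
      ⟨hX0, hX1⟩).summable
    refine ((hP.add hQ).div_const 2).congr fun q => ?_
    simp only [hrZTermAB]
    field_simp

/-- **The odd form as the series of term values, every `Δ` strictly above the bound.**
[cite: DolanOsborn2004, §3 eqs. (3.9)–(3.12)] -/
theorem hasSum_oddForm_of_isTaylorAt_of_lt {x : ℝ} (hx0 : 0 < x) (hx1 : x < 1) (α : CrossingFunctional)
    (hα : IsTaylorAt α x x) {Δσ Δε Δ : ℝ} {ℓ : ℕ} {g₁ g₂ : ℝ → ℝ → ℝ}
    (hΔ : unitarityBound3D ℓ < Δ) (h1 : ℓ = 0 → Δ ≠ 1)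
    (hg₁ : IsConformalBlock3D (Δσ - Δε) (Δσ - Δε) Δ ℓ g₁)
    (hg₂ : IsConformalBlock3D (-(Δσ - Δε)) (Δσ - Δε) Δ ℓ g₂) :
    HasSum (oddTermValue α Δσ Δε Δ ℓ) (α.oddForm Δσ Δε ℓ g₁ g₂) := by
  obtain ⟨-, -, h₃, h₄, h₅⟩ := hα
  have s3 := h₃.hasSum_crossF_hrZTermAB_neg_of_lt hx0 hx1 ((Δσ + Δε) / 2) (-1) hΔ h1 hg₁ hg₂
  have s4 := h₄.hasSum_crossF_hrZTermAB_self_of_lt hx0 hx1 Δσ (-1) hΔ (by ring) hg₂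
  have s5 := h₅.hasSum_crossF_hrZTermAB_self_of_lt hx0 hx1 Δσ 1 hΔ (by ring) hg₂
  have hs := ((s3.mul_left ((-1 : ℝ) ^ ℓ)).add s4).sub s5
  unfold CrossingFunctional.oddForm
  refine hs.congr_fun fun q => ?_
  simp only [oddTermValue]
  ring

/-- **Odd-sector positivity from termwise non-negativity, every `Δ` strictly above the bound** (accidental
degeneracies included; `Δ ≠ 1` if `ℓ = 0`). [cite: KosPolandSimmonsduffin2014, §3.3 eq. (3.16)] -/
theorem oddPositive_of_isTaylorAt_of_termwise_of_lt {x : ℝ} (hx0 : 0 < x) (hx1 : x < 1)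
    (α : CrossingFunctional) (hα : IsTaylorAt α x x) {Δσ Δε Δ : ℝ} {ℓ : ℕ}
    (hΔ : unitarityBound3D ℓ < Δ) (h1 : ℓ = 0 → Δ ≠ 1) (F : Finset (ℕ × ℕ))
    (hhead : 0 ≤ ∑ q ∈ F, oddTermValue α Δσ Δε Δ ℓ q)
    (htail : ∀ q : ℕ × ℕ, q ∉ F → 0 ≤ oddTermValue α Δσ Δε Δ ℓ q) :
    α.OddPositive Δσ Δε Δ ℓ := by
  intro g₁ g₂ hg₁ hg₂
  have hS := hasSum_oddForm_of_isTaylorAt_of_lt hx0 hx1 α hα hΔ h1 hg₁ hg₂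
  exact hhead.trans (sum_le_hasSum F (fun q hq => htail q hq) hS)

/-- **At the unitarity bound `Δ = ℓ+1`, `ℓ ≥ 1`, with `Δσ ≠ Δε`, `OddPositive` is vacuous**: no genuine
`⟨σεσε⟩` block exists there (`not_isConformalBlock3D_of_pole`). [cite: KosPolandSimmonsduffin2014, §4 eqs. (4.2)–(4.3)] -/
theorem oddPositive_bound_of_ne (α : CrossingFunctional) {Δσ Δε : ℝ} (hne : Δσ ≠ Δε) {ℓ : ℕ}
    (hℓ : 1 ≤ ℓ) : α.OddPositive Δσ Δε ((ℓ : ℝ) + 1) ℓ := by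
  intro g₁ g₂ hg₁ _
  have ht : (Δσ - Δε) * (Δσ - Δε) ≠ 0 := by
    have : Δσ - Δε ≠ 0 := sub_ne_zero.mpr hne
    positivity
  exact absurd hg₁ (not_isConformalBlock3D_of_pole ht hℓ g₁)

/-- **(D5) from the dominated termwise inequality.** For a derivative functional Taylor at `(x,x)`, a head
threshold `E₀ > 1` and a set `Q` with `Δσ ≠ Δε`: if at every `(Δσ,Δε) ∈ Q`, every spin `ℓ`, every
`Δ > unitarityBound3D ℓ` with `Δ ≥ E₀` and every `(n,j)` in the descendant range the dominated inequality
`c₊ (φ₄-φ₅) ≥ ((c₊+c̄)/2)|φ₃|` holds, then the odd tail obligation of `MixedObligations α Q E₀` holds.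
[cite: KosPolandSimmonsduffin2014, §3.3 eq. (3.16)] -/
theorem tail_odd_of_dominated {x : ℝ} (hx0 : 0 < x) (hx1 : x < 1) (α : CrossingFunctional)
    (hα : IsTaylorAt α x x) {Q : Set (ℝ × ℝ)} {E₀ : ℝ} (hE₀ : 1 < E₀) (hQ : ∀ p ∈ Q, p.1 ≠ p.2)
    (hdom : ∀ p ∈ Q, ∀ (ℓ : ℕ) (Δ : ℝ), unitarityBound3D ℓ < Δ → E₀ ≤ Δ → ∀ q : ℕ × ℕ,
      InDescendantRange ℓ q.1 q.2 →
      (hrCoeffAB ((p.1 - p.2) / 2) ((p.1 - p.2) / 2) Δ ℓ q.1 q.2 / legendreLam ℓ +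
            hrCoeffAB (-(p.1 - p.2) / 2) (-(p.1 - p.2) / 2) Δ ℓ q.1 q.2 / legendreLam ℓ) / 2 *
          |α.α₃ (crossF ((p.1 + p.2) / 2) (-1) (zMono (Δ + (q.1 : ℝ)) q.2))| ≤
        hrCoeffAB ((p.1 - p.2) / 2) ((p.1 - p.2) / 2) Δ ℓ q.1 q.2 / legendreLam ℓ *
          (α.α₄ (crossF p.1 (-1) (zMono (Δ + (q.1 : ℝ)) q.2)) -
            α.α₅ (crossF p.1 1 (zMono (Δ + (q.1 : ℝ)) q.2)))) :
    ∀ p ∈ Q, ∀ ℓ : ℕ, ∀ Δ : ℝ, unitarityBound3D ℓ ≤ Δ → E₀ ≤ Δ → α.OddPositive p.1 p.2 Δ ℓ := by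
  intro p hp ℓ Δ hb hE
  rcases hb.lt_or_eq with hlt | heq
  · have h1 : ℓ = 0 → Δ ≠ 1 := fun _ hΔ => by linarith
    refine oddPositive_of_isTaylorAt_of_termwise_of_lt hx0 hx1 α hα hlt h1 ∅ (by simp)
      fun q _ => ?_
    by_cases hr : InDescendantRange ℓ q.1 q.2
    · exact oddTermValue_nonneg_of_dominated' α p.1 p.2 Δ hlt h1 q (hdom p hp ℓ Δ hlt hE q hr)
    · unfold oddTermValue
      rw [hrCoeffAB_eq_zero_of_not_inDescendantRange _ _ Δ hr,
        hrCoeffAB_eq_zero_of_not_inDescendantRange _ _ Δ hr]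
      simp
  · -- Δ is exactly at the bound: ℓ = 0 impossible (bound 1/2 < 1 < E₀), else vacuous
    rcases Nat.eq_zero_or_pos ℓ with hℓ | hℓ
    · subst hℓ
      have : unitarityBound3D 0 = 1 / 2 := by simp [unitarityBound3D]
      rw [this] at heq
      linarith
    · have hb' : unitarityBound3D ℓ = (ℓ : ℝ) + 1 := by
        unfold unitarityBound3D; rw [if_neg (by omega)]
      rw [← heq, hb']
      exact oddPositive_bound_of_ne α (hQ p hp) hℓ

end Summit.CriticalPhenomena.Ising3D
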